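import Summits.QuantumFields.YangMills.Theorems.UnitScaleTiltProp7PlaquetteCurlComparison
import Literature.MathematicalPhysics.QuantumFieldTheory.Balaban1983to89.BlockAveragingEMLLinearisedBackground
import Literature.MathematicalPhysics.QuantumFieldTheory.Balaban1983to89.B15Ineq146Proof
import HarnessLib

/-!
# Prop 7, route-R E′ (A′)-on-Σ, P-A2∕F4″ — THE CURRENCY EXCHANGE `pertVar ↔ X` BETWEEN (n3)∕F3″'s LETTERS AND THE JOINT DOOR'S

Route `UnitScaleTilt`, crux K1 «MinimiserStabilityRegPr» (`stmt-QuantumFields-19200`), route-R v2; cell `ym3-torus`, width seat `ym-routeR-w4` (gen 15); ★p1 g17 WORD 27 (b).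
Helper only (`--supports`), def-free, count-neutral.  WHY: F3″∕(n3) (✓ `Prop7TwistedLevelMassT3`, ✓ `Prop7FibreLevelMassPerLevelT3`) speak the `pertVar` currency of the
competitor `U` against the background `U₀` — bond mass `Σ_b ‖pertVar U₀ U b‖²`, the Hilbert–Schmidt curl and divergence energies of the `B9Eq39Adjoint` calculus on the torus —
while the JOINT conjunct of ✓ `Prop7HcoSOfSigmaRows.hcoS_of_sigmaRowsS` (fed by ✓ `Prop7JointSigmaOfCmapTwL1.jointRow_of_l1_CmapTw`) speaks the EXPONENT `X` (`U(b) = e^{iX(b)}U₀(b)`,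
`X(b)` Hermitian): `M = Σ_b‖X b‖²`, the door's plaquette form `K_{U₀}(iX)`, a divergence mass.  This is the second-order exchange the F4″ assembler plugs between the two.

WHAT IS PROVED (any `P`, level `i`, `SU(N)`; `X` bondwise Hermitian, `U(b) = exp(iX(b))·U₀(b)` as matrices, `‖X b‖ ≤ s`, `dist1(U₀(∂p)) ≤ a`).
§1 `pertVar_eq_exp_sub_one`, `norm_pertVar_le` (`≤ ‖X b‖`, lit ✓ `B8Ineq170.norm_exp_I_smul_sub_one_le`), `norm_pertVar_sub_lin_le` (`‖pertVar − iX‖ ≤ ‖X‖²∕2`, lit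
✓ `B15Ineq146Proof.norm_exp_sub_one_sub_le_of_skew`); §2 ★ `sum_normSq_pertVar_le` — MASS `Σ‖pertVar‖² ≤ Σ‖X‖²`; §3 ★★ `curlHS_pertVar_le` — `CURL_HS(pertVar) ≤ 2·CURL_HS(iX)
+ 8·N·d·s²·M`, ★★★ `curlHS_pertVar_le_plaqK` (∘ ✓ `Prop7PlaquetteCurlComparison.curlHS_le_plaqK`) — `CURL_HS(pertVar) ≤ 4N·K_{U₀}(iX) + N·d·(64a² + 8s²)·M` in the door's plaquette
letter VERBATIM; §4 `divB_torus_eq`, ★★ `divHS_pertVar_le` — `DIV_HS(pertVar) ≤ 2·DIV_HS(iX) + 2·N·d·s²·M`.  With `s ≤ 2B₁′e·ℓ⁻¹` ((19)) the spill `ℓ·s²·M ≤ 4B₁′²e²·ℓ⁻¹M` lands in the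
`C₁ℓ⁻¹M` slot of the JOINT binder; `a ≤ 2ε₀ℓ⁻²` at a printed-regular background.  HONEST SCOPE: second-order Taylor of `e^{iX}` and finite bookkeeping; constants ours; nothing of
P-A2, `hcoS`, E′, EX, the stub or the crux is claimed; YM₃ on T³ is ladder rung R3 — not d = 4, not infinite volume, not a mass gap, not Clay.

References: T. Bałaban, CMP 102 (1985) 277–309 [Balaban1985Variational] ((15) p.280, (19)–(20) p.281, (47)–(48) pp.285–286, (135) p.298); CMP 99 (1985) 389–434
[Balaban1985BackgroundPropagators] ((3.3)–(3.5) p.391, (3.8) p.392); CMP 98 (1985) 17–51 [Balaban1985Averaging] ((5) p.18, (19), (24) p.21); CMP 99 (1985) 75–102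
[Balaban1985RegularSpaces] (p.84).
-/

set_option autoImplicit false

noncomputable section

open scoped BigOperators Matrix.Norms.L2Operator Matrix
open NormedSpace

namespace Summit.QuantumFields.YangMills.Theorems.Prop7PertVarCurrencyExchange

open Literature.MathematicalPhysics.QuantumFieldTheory.Balaban1983to89
open Finset B1RG242Torus
open T4Continuum BlockAveraging BlockAveragingEMLLinearisedBackground
open B9Eq39Adjoint (R R_def covD covDstar curl divB)
open B10StarCount (sum_pbond)
open B10Eq27TorusAxialLog (unitsField toUField)
open B9TorusCalculus (torusT torusT_apply torusT_symm_apply)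
open Summit.QuantumFields.YangMills.Theorems.Prop7HolRatioPerStep (coe_mul_star_self coe_star_mul_self)
open Summit.QuantumFields.YangMills.Theorems.Prop7CovIterLambdaBound (norm_conj_su_le)
open Summit.QuantumFields.YangMills.Theorems.Prop7CovariantCoercivity (sum_norm_sq_le_mul_opNorm_sq)
open Summit.QuantumFields.YangMills.Theorems.Prop7PinnedRegaugeChartDivergence (coe_inv_eq_star R_inv_eq_star_mul)
open Summit.QuantumFields.YangMills.Theorems.Prop7PinnedRegaugeChartDivergenceTorus (coe_unitsField_toUField)
open Summit.QuantumFields.YangMills.Theorems.Prop7PinnedRegaugeChartDivergenceHRK (sum_plaq_le_sum_site_dir sum_site_dir_dir_shift_eq)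
open Summit.QuantumFields.YangMills.Theorems.Prop7PlaquetteCurlComparison (curl_torus_eq sum_ite_eq_sum_plaq curlHS_le_plaqK)

variable {P : Params} {N : ℕ} [NeZero N] {i : ℕ}

/-! ## §1 The letters: `pertVar = e^{iX} − 1`, first and second order -/

section Letters

variable (U₀ U : GaugeField P i (Matrix.specialUnitaryGroup (Fin N) ℂ)) (X : PBond P i → Matrix (Fin N) (Fin N) ℂ)

omit [NeZero N] in
/-- `iX` is skew-adjoint when `X` is Hermitian. [folklore] -/
theorem I_smul_mem_skewAdjoint {Y : Matrix (Fin N) (Fin N) ℂ} (hY : Y.IsHermitian) :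
    Complex.I • Y ∈ skewAdjoint (Matrix (Fin N) (Fin N) ℂ) := by
  refine skewAdjoint.mem_iff.2 ?_
  rw [star_smul, Complex.star_def, Complex.conj_I, hY.star_eq, neg_smul]

/-- `‖a + b‖² ≤ 2‖a‖² + 2‖b‖²`. [folklore] -/
theorem normSq_add_le {E : Type*} [SeminormedAddCommGroup E] (a b : E) : ‖a + b‖ ^ 2 ≤ 2 * ‖a‖ ^ 2 + 2 * ‖b‖ ^ 2 := by
  nlinarith [norm_add_le a b, norm_nonneg (a + b), norm_nonneg a, norm_nonneg b, sq_nonneg (‖a‖ - ‖b‖)]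

omit [NeZero N] in
/-- **THE PERTURBATION VARIABLE OF A CHART POINT**: if `U(b) = e^{iX(b)}·U₀(b)` then `pertVar U₀ U b = e^{iX(b)} − 1`. [cite: Balaban1985Variational, (15) p.280, (19) p.281] -/
theorem pertVar_eq_exp_sub_one
    (hU : ∀ b, ((U b : Matrix.specialUnitaryGroup (Fin N) ℂ) : Matrix (Fin N) (Fin N) ℂ)
      = exp (Complex.I • X b) * ((U₀ b : Matrix.specialUnitaryGroup (Fin N) ℂ) : Matrix (Fin N) (Fin N) ℂ)) (b : PBond P i) :
    pertVar U₀ U b = exp (Complex.I • X b) - 1 := by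
  rw [pertVar_eq, hU b, mul_assoc, coe_mul_star_self, mul_one]

omit [NeZero N] in
/-- **FIRST ORDER**: `‖pertVar U₀ U b‖ ≤ ‖X b‖` (`|e^{iX} − 1| ≤ |X|` for Hermitian `X`, [Balaban1985Averaging] (24)). [cite: Balaban1985Averaging, (24) p.21] -/
theorem norm_pertVar_le (hX : ∀ b, (X b).IsHermitian)
    (hU : ∀ b, ((U b : Matrix.specialUnitaryGroup (Fin N) ℂ) : Matrix (Fin N) (Fin N) ℂ)
      = exp (Complex.I • X b) * ((U₀ b : Matrix.specialUnitaryGroup (Fin N) ℂ) : Matrix (Fin N) (Fin N) ℂ)) (b : PBond P i) :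
    ‖pertVar U₀ U b‖ ≤ ‖X b‖ := by
  letI : CStarAlgebra (Matrix (Fin N) (Fin N) ℂ) := B10Eq29TubeLine.cstarAlgebraMatrix N
  rw [pertVar_eq_exp_sub_one U₀ U X hU b]
  exact B8Ineq170.norm_exp_I_smul_sub_one_le (hX b).isSelfAdjoint

omit [NeZero N] in
/-- **SECOND ORDER**: `‖pertVar U₀ U b − iX(b)‖ ≤ ‖X b‖²∕2` (`|e^{iX} − 1 − iX| ≤ ½|X|²`, the unitary sharp form). [cite: Balaban1985RegularSpaces, p.84] -/
theorem norm_pertVar_sub_lin_le (hX : ∀ b, (X b).IsHermitian)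
    (hU : ∀ b, ((U b : Matrix.specialUnitaryGroup (Fin N) ℂ) : Matrix (Fin N) (Fin N) ℂ)
      = exp (Complex.I • X b) * ((U₀ b : Matrix.specialUnitaryGroup (Fin N) ℂ) : Matrix (Fin N) (Fin N) ℂ)) (b : PBond P i) :
    ‖pertVar U₀ U b - Complex.I • X b‖ ≤ ‖X b‖ ^ 2 / 2 := by
  letI : CStarAlgebra (Matrix (Fin N) (Fin N) ℂ) := B10Eq29TubeLine.cstarAlgebraMatrix N
  rw [pertVar_eq_exp_sub_one U₀ U X hU b, show ‖X b‖ = ‖Complex.I • X b‖ by rw [norm_smul, Complex.norm_I, one_mul]]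
  exact B15Ineq146Proof.norm_exp_sub_one_sub_le_of_skew (I_smul_mem_skewAdjoint (hX b))

omit [NeZero N] in
/-- The second-order remainder against the bond mass under a sup `‖X b‖ ≤ s`: `‖pertVar − iX‖² ≤ (s²∕4)·‖X b‖²`. [cite: Balaban1985Variational, (19) p.281] -/
theorem normSq_pertVar_sub_lin_le (hX : ∀ b, (X b).IsHermitian)
    (hU : ∀ b, ((U b : Matrix.specialUnitaryGroup (Fin N) ℂ) : Matrix (Fin N) (Fin N) ℂ)
      = exp (Complex.I • X b) * ((U₀ b : Matrix.specialUnitaryGroup (Fin N) ℂ) : Matrix (Fin N) (Fin N) ℂ))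
    {s : ℝ} (hs : ∀ b, ‖X b‖ ≤ s) (b : PBond P i) :
    ‖pertVar U₀ U b - Complex.I • X b‖ ^ 2 ≤ s ^ 2 / 4 * ‖X b‖ ^ 2 := by
  have h := norm_pertVar_sub_lin_le U₀ U X hX hU b
  have h0 : 0 ≤ ‖pertVar U₀ U b - Complex.I • X b‖ := norm_nonneg _
  have hXb : 0 ≤ ‖X b‖ := norm_nonneg _
  have h1 : ‖pertVar U₀ U b - Complex.I • X b‖ ≤ s / 2 * ‖X b‖ :=
    h.trans (by nlinarith [mul_le_mul_of_nonneg_right (hs b) hXb])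
  calc ‖pertVar U₀ U b - Complex.I • X b‖ ^ 2 ≤ (s / 2 * ‖X b‖) ^ 2 := pow_le_pow_left₀ h0 h1 2
    _ = s ^ 2 / 4 * ‖X b‖ ^ 2 := by ring

/-! ## §2 The bond mass -/

omit [NeZero N] in
/-- ★ **MASS**: `Σ_b ‖pertVar U₀ U b‖² ≤ Σ_b ‖X b‖²`. [cite: Balaban1985Variational, (15) p.280, (19) p.281] -/
theorem sum_normSq_pertVar_le (hX : ∀ b, (X b).IsHermitian)
    (hU : ∀ b, ((U b : Matrix.specialUnitaryGroup (Fin N) ℂ) : Matrix (Fin N) (Fin N) ℂ)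
      = exp (Complex.I • X b) * ((U₀ b : Matrix.specialUnitaryGroup (Fin N) ℂ) : Matrix (Fin N) (Fin N) ℂ)) :
    ∑ b : PBond P i, ‖pertVar U₀ U b‖ ^ 2 ≤ ∑ b : PBond P i, ‖X b‖ ^ 2 :=
  Finset.sum_le_sum fun b _ => pow_le_pow_left₀ (norm_nonneg _) (norm_pertVar_le U₀ U X hX hU b) 2

end Letters

/-! ## §3 The Hilbert–Schmidt curl energy -/

section Curl

variable (U₀ : GaugeField P i (Matrix.specialUnitaryGroup (Fin N) ℂ))

omit [NeZero N] in
/-- The curl is additive in the bond field (a splitting `Z = Z₁ + Z₂`). [folklore] -/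
theorem curl_eq_add_of_split (Z Z₁ Z₂ : PBond P i → Matrix (Fin N) (Fin N) ℂ) (hZ : ∀ b, Z b = Z₁ b + Z₂ b) (μ ν : Fin P.d) (x : Site P i) :
    curl (torusT P i) (fun κ z => unitsField (toUField U₀) ⟨z, κ⟩) (fun κ z => Z ⟨z, κ⟩) μ ν x
      = curl (torusT P i) (fun κ z => unitsField (toUField U₀) ⟨z, κ⟩) (fun κ z => Z₁ ⟨z, κ⟩) μ ν x
        + curl (torusT P i) (fun κ z => unitsField (toUField U₀) ⟨z, κ⟩) (fun κ z => Z₂ ⟨z, κ⟩) μ ν x := by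
  rw [curl_torus_eq, curl_torus_eq, curl_torus_eq, hZ, hZ, hZ, hZ]
  simp only [mul_add, add_mul]
  abel

/-- The curl of a bond field at a plaquette is at most the sum of its four letters' norms (unitary conjugations). [cite: Balaban1985BackgroundPropagators, (3.4) p.391] -/
theorem norm_curl_le_four (Rm : PBond P i → Matrix (Fin N) (Fin N) ℂ) (μ ν : Fin P.d) (x : Site P i) :
    ‖curl (torusT P i) (fun κ z => unitsField (toUField U₀) ⟨z, κ⟩) (fun κ z => Rm ⟨z, κ⟩) μ ν x‖
      ≤ ‖Rm ⟨x, μ⟩‖ + ‖Rm ⟨x.shift μ, ν⟩‖ + ‖Rm ⟨x.shift ν, μ⟩‖ + ‖Rm ⟨x, ν⟩‖ := by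
  rw [curl_torus_eq]
  have h2 := norm_conj_su_le (U₀ ⟨x, μ⟩) (Rm ⟨x.shift μ, ν⟩)
  have h3 := norm_conj_su_le (U₀ ⟨x, ν⟩) (Rm ⟨x.shift ν, μ⟩)
  calc _ ≤ ‖Rm ⟨x, μ⟩ + (U₀ ⟨x, μ⟩ : Matrix (Fin N) (Fin N) ℂ) * Rm ⟨x.shift μ, ν⟩ * star (U₀ ⟨x, μ⟩ : Matrix (Fin N) (Fin N) ℂ)
            - (U₀ ⟨x, ν⟩ : Matrix (Fin N) (Fin N) ℂ) * Rm ⟨x.shift ν, μ⟩ * star (U₀ ⟨x, ν⟩ : Matrix (Fin N) (Fin N) ℂ)‖ + ‖Rm ⟨x, ν⟩‖ := norm_sub_le _ _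
    _ ≤ ‖Rm ⟨x, μ⟩ + (U₀ ⟨x, μ⟩ : Matrix (Fin N) (Fin N) ℂ) * Rm ⟨x.shift μ, ν⟩ * star (U₀ ⟨x, μ⟩ : Matrix (Fin N) (Fin N) ℂ)‖
          + ‖(U₀ ⟨x, ν⟩ : Matrix (Fin N) (Fin N) ℂ) * Rm ⟨x.shift ν, μ⟩ * star (U₀ ⟨x, ν⟩ : Matrix (Fin N) (Fin N) ℂ)‖ + ‖Rm ⟨x, ν⟩‖ := by
          gcongr; exact norm_sub_le _ _
    _ ≤ ‖Rm ⟨x, μ⟩‖ + ‖(U₀ ⟨x, μ⟩ : Matrix (Fin N) (Fin N) ℂ) * Rm ⟨x.shift μ, ν⟩ * star (U₀ ⟨x, μ⟩ : Matrix (Fin N) (Fin N) ℂ)‖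
          + ‖(U₀ ⟨x, ν⟩ : Matrix (Fin N) (Fin N) ℂ) * Rm ⟨x.shift ν, μ⟩ * star (U₀ ⟨x, ν⟩ : Matrix (Fin N) (Fin N) ℂ)‖ + ‖Rm ⟨x, ν⟩‖ := by
          gcongr; exact norm_add_le _ _
    _ ≤ ‖Rm ⟨x, μ⟩‖ + ‖Rm ⟨x.shift μ, ν⟩‖ + ‖Rm ⟨x.shift ν, μ⟩‖ + ‖Rm ⟨x, ν⟩‖ := by gcongr

/-- The HS curl energy of a REMAINDER field against its bond mass: `CURL_HS(Rm) ≤ 16·N·d·Σ_b‖Rm b‖²` (each plaquette `≤ N·(4 letters)² ≤ 4N·Σ`, each bond in `≤ 4d` slots).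
[cite: Balaban1985Averaging, (5) p.18] [cite: Balaban1985BackgroundPropagators, (3.4) p.391] -/
theorem curlHS_le_bondMass (Rm : PBond P i → Matrix (Fin N) (Fin N) ℂ) :
    (∑ x : Site P i, ∑ μ : Fin P.d, ∑ ν : Fin P.d,
        (if μ < ν then ∑ j : Fin N, ∑ k : Fin N,
          ‖(curl (torusT P i) (fun κ z => unitsField (toUField U₀) ⟨z, κ⟩) (fun κ z => Rm ⟨z, κ⟩) μ ν x) j k‖ ^ 2 else 0))
      ≤ 16 * N * P.d * ∑ b : PBond P i, ‖Rm b‖ ^ 2 := by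
  -- drop the `if`, HS ≤ N·op², op ≤ four letters
  have h1 : (∑ x : Site P i, ∑ μ : Fin P.d, ∑ ν : Fin P.d,
        (if μ < ν then ∑ j : Fin N, ∑ k : Fin N,
          ‖(curl (torusT P i) (fun κ z => unitsField (toUField U₀) ⟨z, κ⟩) (fun κ z => Rm ⟨z, κ⟩) μ ν x) j k‖ ^ 2 else 0))
      ≤ ∑ x : Site P i, ∑ μ : Fin P.d, ∑ ν : Fin P.d,
          4 * N * (‖Rm ⟨x, μ⟩‖ ^ 2 + ‖Rm ⟨x.shift μ, ν⟩‖ ^ 2 + ‖Rm ⟨x.shift ν, μ⟩‖ ^ 2 + ‖Rm ⟨x, ν⟩‖ ^ 2) := by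
    refine Finset.sum_le_sum fun x _ => Finset.sum_le_sum fun μ _ => Finset.sum_le_sum fun ν _ => ?_
    have hN : (0 : ℝ) ≤ N := Nat.cast_nonneg N
    have hsq : 0 ≤ ‖Rm ⟨x, μ⟩‖ ^ 2 + ‖Rm ⟨x.shift μ, ν⟩‖ ^ 2 + ‖Rm ⟨x.shift ν, μ⟩‖ ^ 2 + ‖Rm ⟨x, ν⟩‖ ^ 2 := by positivity
    split_ifs
    · refine (sum_norm_sq_le_mul_opNorm_sq _).trans ?_
      have h4 := norm_curl_le_four U₀ Rm μ ν x
      have h0 : 0 ≤ ‖curl (torusT P i) (fun κ z => unitsField (toUField U₀) ⟨z, κ⟩) (fun κ z => Rm ⟨z, κ⟩) μ ν x‖ := norm_nonneg _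
      have hsq4 := pow_le_pow_left₀ h0 h4 2
      have hcs : (‖Rm ⟨x, μ⟩‖ + ‖Rm ⟨x.shift μ, ν⟩‖ + ‖Rm ⟨x.shift ν, μ⟩‖ + ‖Rm ⟨x, ν⟩‖) ^ 2
          ≤ 4 * (‖Rm ⟨x, μ⟩‖ ^ 2 + ‖Rm ⟨x.shift μ, ν⟩‖ ^ 2 + ‖Rm ⟨x.shift ν, μ⟩‖ ^ 2 + ‖Rm ⟨x, ν⟩‖ ^ 2) := by
        nlinarith [sq_nonneg (‖Rm ⟨x, μ⟩‖ - ‖Rm ⟨x.shift μ, ν⟩‖), sq_nonneg (‖Rm ⟨x, μ⟩‖ - ‖Rm ⟨x.shift ν, μ⟩‖), sq_nonneg (‖Rm ⟨x, μ⟩‖ - ‖Rm ⟨x, ν⟩‖),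
          sq_nonneg (‖Rm ⟨x.shift μ, ν⟩‖ - ‖Rm ⟨x.shift ν, μ⟩‖), sq_nonneg (‖Rm ⟨x.shift μ, ν⟩‖ - ‖Rm ⟨x, ν⟩‖), sq_nonneg (‖Rm ⟨x.shift ν, μ⟩‖ - ‖Rm ⟨x, ν⟩‖)]
      nlinarith [mul_le_mul_of_nonneg_left (hsq4.trans hcs) hN]
    · positivity
  refine h1.trans ?_
  obtain ⟨e1, e2, e3, e4⟩ := sum_site_dir_dir_shift_eq (P := P) (i := i) Rm
  have hsplit : ∑ x : Site P i, ∑ μ : Fin P.d, ∑ ν : Fin P.d,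
          4 * N * (‖Rm ⟨x, μ⟩‖ ^ 2 + ‖Rm ⟨x.shift μ, ν⟩‖ ^ 2 + ‖Rm ⟨x.shift ν, μ⟩‖ ^ 2 + ‖Rm ⟨x, ν⟩‖ ^ 2)
      = 4 * N * ((∑ x : Site P i, ∑ μ : Fin P.d, ∑ _ν : Fin P.d, ‖Rm ⟨x, μ⟩‖ ^ 2)
          + (∑ x : Site P i, ∑ μ : Fin P.d, ∑ ν : Fin P.d, ‖Rm ⟨x.shift μ, ν⟩‖ ^ 2)
          + (∑ x : Site P i, ∑ μ : Fin P.d, ∑ ν : Fin P.d, ‖Rm ⟨x.shift ν, μ⟩‖ ^ 2)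
          + (∑ x : Site P i, ∑ _μ : Fin P.d, ∑ ν : Fin P.d, ‖Rm ⟨x, ν⟩‖ ^ 2)) := by
    simp only [Finset.mul_sum, Finset.sum_add_distrib, mul_add]
  rw [hsplit, e1, e2, e3, e4]
  ring_nf
  rfl

variable (U : GaugeField P i (Matrix.specialUnitaryGroup (Fin N) ℂ)) (X : PBond P i → Matrix (Fin N) (Fin N) ℂ)

/-- ★★ **CURL, SECOND-ORDER EXCHANGE**: `CURL_HS(pertVar U₀ U) ≤ 2·CURL_HS(iX) + 8·N·d·s²·Σ_b‖X b‖²` (background `U₀` on both sides; `‖X b‖ ≤ s`).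
[cite: Balaban1985Variational, (15) p.280, (19) p.281, (135) p.298] [cite: Balaban1985BackgroundPropagators, (3.4) p.391] -/
theorem curlHS_pertVar_le (hX : ∀ b, (X b).IsHermitian)
    (hU : ∀ b, ((U b : Matrix.specialUnitaryGroup (Fin N) ℂ) : Matrix (Fin N) (Fin N) ℂ)
      = exp (Complex.I • X b) * ((U₀ b : Matrix.specialUnitaryGroup (Fin N) ℂ) : Matrix (Fin N) (Fin N) ℂ))
    {s : ℝ} (hs : ∀ b, ‖X b‖ ≤ s) :
    (∑ x : Site P i, ∑ μ : Fin P.d, ∑ ν : Fin P.d,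
        (if μ < ν then ∑ j : Fin N, ∑ k : Fin N,
          ‖(curl (torusT P i) (fun κ z => unitsField (toUField U₀) ⟨z, κ⟩) (fun κ z => pertVar U₀ U ⟨z, κ⟩) μ ν x) j k‖ ^ 2 else 0))
      ≤ 2 * (∑ x : Site P i, ∑ μ : Fin P.d, ∑ ν : Fin P.d,
          (if μ < ν then ∑ j : Fin N, ∑ k : Fin N,
            ‖(curl (torusT P i) (fun κ z => unitsField (toUField U₀) ⟨z, κ⟩) (fun κ z => Complex.I • X ⟨z, κ⟩) μ ν x) j k‖ ^ 2 else 0))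
        + 8 * N * P.d * s ^ 2 * ∑ b : PBond P i, ‖X b‖ ^ 2 := by
  -- pointwise (under the `if`): `|a + b|² ≤ 2|a|² + 2|b|²` entrywise after the splitting `pertVar = iX + (pertVar − iX)`
  have hpt : ∀ (x : Site P i) (μ ν : Fin P.d),
      (if μ < ν then ∑ j : Fin N, ∑ k : Fin N,
          ‖(curl (torusT P i) (fun κ z => unitsField (toUField U₀) ⟨z, κ⟩) (fun κ z => pertVar U₀ U ⟨z, κ⟩) μ ν x) j k‖ ^ 2 else 0)
        ≤ 2 * (if μ < ν then ∑ j : Fin N, ∑ k : Fin N,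
            ‖(curl (torusT P i) (fun κ z => unitsField (toUField U₀) ⟨z, κ⟩) (fun κ z => Complex.I • X ⟨z, κ⟩) μ ν x) j k‖ ^ 2 else 0)
          + 2 * (if μ < ν then ∑ j : Fin N, ∑ k : Fin N,
            ‖(curl (torusT P i) (fun κ z => unitsField (toUField U₀) ⟨z, κ⟩) (fun κ z => pertVar U₀ U ⟨z, κ⟩ - Complex.I • X ⟨z, κ⟩) μ ν x) j k‖ ^ 2 else 0) := by
    intro x μ ν
    split_ifs
    · rw [curl_eq_add_of_split U₀ (pertVar U₀ U) (fun b => Complex.I • X b) (fun b => pertVar U₀ U b - Complex.I • X b) (fun b => by abel) μ ν x,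
        Finset.mul_sum, Finset.mul_sum, ← Finset.sum_add_distrib]
      refine Finset.sum_le_sum fun j _ => ?_
      rw [Finset.mul_sum, Finset.mul_sum, ← Finset.sum_add_distrib]
      refine Finset.sum_le_sum fun k _ => ?_
      rw [Matrix.add_apply]
      exact normSq_add_le _ _
    · simp
  have hsum := Finset.sum_le_sum fun x (_ : x ∈ (Finset.univ : Finset (Site P i))) =>
    Finset.sum_le_sum fun μ (_ : μ ∈ (Finset.univ : Finset (Fin P.d))) => Finset.sum_le_sum fun ν (_ : ν ∈ (Finset.univ : Finset (Fin P.d))) => hpt x μ ν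
  refine hsum.trans ?_
  simp only [Finset.sum_add_distrib, ← Finset.mul_sum]
  -- the remainder part against the bond mass
  have hrem := curlHS_le_bondMass U₀ (fun b => pertVar U₀ U b - Complex.I • X b)
  beta_reduce at hrem
  have hmass : ∑ b : PBond P i, ‖pertVar U₀ U b - Complex.I • X b‖ ^ 2 ≤ s ^ 2 / 4 * ∑ b : PBond P i, ‖X b‖ ^ 2 := by
    rw [Finset.mul_sum]
    exact Finset.sum_le_sum fun b _ => normSq_pertVar_sub_lin_le U₀ U X hX hU hs b
  have hN : (0 : ℝ) ≤ 16 * N * P.d := by positivity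
  nlinarith [mul_le_mul_of_nonneg_left hmass hN, hrem]

/-- ★★★ **CURL, IN THE DOOR'S PLAQUETTE LETTER**: with `dist1(U₀(∂p)) ≤ a`,
`CURL_HS(pertVar U₀ U) ≤ 4N·K_{U₀}(iX) + N·d·(64·a² + 8·s²)·Σ_b‖X b‖²`, `K_{U₀}` the JOINT door's plaquette form (✓ `curlHS_le_plaqK` ∘ §3).
[cite: Balaban1985Variational, (47)-(48) pp.285-286, (135) p.298] [cite: Balaban1985BackgroundPropagators, (3.4) p.391] -/
theorem curlHS_pertVar_le_plaqK (hX : ∀ b, (X b).IsHermitian)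
    (hU : ∀ b, ((U b : Matrix.specialUnitaryGroup (Fin N) ℂ) : Matrix (Fin N) (Fin N) ℂ)
      = exp (Complex.I • X b) * ((U₀ b : Matrix.specialUnitaryGroup (Fin N) ℂ) : Matrix (Fin N) (Fin N) ℂ))
    {s : ℝ} (hs : ∀ b, ‖X b‖ ≤ s) {a : ℝ} (ha : ∀ p : Plaq P i, dist1 (GaugeField.plaqHol U₀ p) ≤ a) :
    (∑ x : Site P i, ∑ μ : Fin P.d, ∑ ν : Fin P.d,
        (if μ < ν then ∑ j : Fin N, ∑ k : Fin N,
          ‖(curl (torusT P i) (fun κ z => unitsField (toUField U₀) ⟨z, κ⟩) (fun κ z => pertVar U₀ U ⟨z, κ⟩) μ ν x) j k‖ ^ 2 else 0))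
      ≤ 4 * N * (∑ p : Plaq P i, ‖((Complex.I • X ⟨p.src, p.μ⟩)
          + ((U₀ ⟨p.src, p.μ⟩ : Matrix (Fin N) (Fin N) ℂ) * (Complex.I • X ⟨p.src.shift p.μ, p.ν⟩) * star (U₀ ⟨p.src, p.μ⟩ : Matrix (Fin N) (Fin N) ℂ))
          - (((U₀ ⟨p.src, p.μ⟩ * U₀ ⟨p.src.shift p.μ, p.ν⟩ * (U₀ ⟨p.src.shift p.ν, p.μ⟩)⁻¹ : Matrix.specialUnitaryGroup (Fin N) ℂ) : Matrix (Fin N) (Fin N) ℂ)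
              * (Complex.I • X ⟨p.src.shift p.ν, p.μ⟩)
              * star ((U₀ ⟨p.src, p.μ⟩ * U₀ ⟨p.src.shift p.μ, p.ν⟩ * (U₀ ⟨p.src.shift p.ν, p.μ⟩)⁻¹ : Matrix.specialUnitaryGroup (Fin N) ℂ) : Matrix (Fin N) (Fin N) ℂ))
          - (((GaugeField.plaqHol U₀ p : Matrix.specialUnitaryGroup (Fin N) ℂ) : Matrix (Fin N) (Fin N) ℂ) * (Complex.I • X ⟨p.src, p.ν⟩)
              * star ((GaugeField.plaqHol U₀ p : Matrix.specialUnitaryGroup (Fin N) ℂ) : Matrix (Fin N) (Fin N) ℂ)))‖ ^ 2)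
        + N * P.d * (64 * a ^ 2 + 8 * s ^ 2) * ∑ b : PBond P i, ‖X b‖ ^ 2 := by
  have h1 := curlHS_pertVar_le U₀ U X hX hU hs
  have h2 := curlHS_le_plaqK U₀ ha X
  nlinarith [h1, h2]

end Curl

/-! ## §4 The Hilbert–Schmidt divergence energy -/

section Div

variable (U₀ : GaugeField P i (Matrix.specialUnitaryGroup (Fin N) ℂ))

omit [NeZero N] in
/-- The `B9Eq39Adjoint` divergence on the torus in bond letters: `(D*Z)(x) = Σ_μ (U₀(x−e_μ,μ)*·Z(x−e_μ,μ)·U₀(x−e_μ,μ) − Z(x,μ))`.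
[cite: Balaban1985BackgroundPropagators, (3.8) p.392, (3.5) p.391] -/
theorem divB_torus_eq (Z : PBond P i → Matrix (Fin N) (Fin N) ℂ) (x : Site P i) :
    divB (torusT P i) (fun κ z => unitsField (toUField U₀) ⟨z, κ⟩) (fun κ z => Z ⟨z, κ⟩) x
      = ∑ μ : Fin P.d, (star ((U₀ ⟨x.unshift μ, μ⟩ : Matrix.specialUnitaryGroup (Fin N) ℂ) : Matrix (Fin N) (Fin N) ℂ) * Z ⟨x.unshift μ, μ⟩
          * ((U₀ ⟨x.unshift μ, μ⟩ : Matrix.specialUnitaryGroup (Fin N) ℂ) : Matrix (Fin N) (Fin N) ℂ) - Z ⟨x, μ⟩) := by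
  have hUW := coe_unitsField_toUField U₀
  simp only [divB, covDstar, torusT_symm_apply, R_inv_eq_star_mul _ (fun κ z => U₀ ⟨z, κ⟩) hUW]

/-- The divergence of a bond field at a site is at most the sum of its `2d` letters' norms. [cite: Balaban1985BackgroundPropagators, (3.8) p.392] -/
theorem norm_divB_le_sum (Rm : PBond P i → Matrix (Fin N) (Fin N) ℂ) (x : Site P i) :
    ‖divB (torusT P i) (fun κ z => unitsField (toUField U₀) ⟨z, κ⟩) (fun κ z => Rm ⟨z, κ⟩) x‖
      ≤ ∑ μ : Fin P.d, (‖Rm ⟨x.unshift μ, μ⟩‖ + ‖Rm ⟨x, μ⟩‖) := by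
  rw [divB_torus_eq]
  refine (norm_sum_le _ _).trans (Finset.sum_le_sum fun μ _ => ?_)
  refine (norm_sub_le _ _).trans ?_
  gcongr
  have h := norm_conj_su_le (star (U₀ ⟨x.unshift μ, μ⟩)) (Rm ⟨x.unshift μ, μ⟩)
  rwa [Matrix.specialUnitaryGroup.coe_star, star_star] at h

/-- The HS divergence energy of a REMAINDER field against its bond mass: `DIV_HS(Rm) ≤ 4·N·d·Σ_b‖Rm b‖²`. [cite: Balaban1985Averaging, (5) p.18] [cite: Balaban1985BackgroundPropagators, (3.8) p.392] -/
theorem divHS_le_bondMass (Rm : PBond P i → Matrix (Fin N) (Fin N) ℂ) :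
    ∑ x : Site P i, ∑ j : Fin N, ∑ k : Fin N,
        ‖(divB (torusT P i) (fun κ z => unitsField (toUField U₀) ⟨z, κ⟩) (fun κ z => Rm ⟨z, κ⟩) x) j k‖ ^ 2
      ≤ 4 * N * P.d * ∑ b : PBond P i, ‖Rm b‖ ^ 2 := by
  have hN : (0 : ℝ) ≤ N := Nat.cast_nonneg N
  -- per site: HS ≤ N·op² ≤ N·(Σ_μ (a_μ + b_μ))² ≤ N·2d·Σ_μ (a_μ² + b_μ²)
  have hpt : ∀ x : Site P i, ∑ j : Fin N, ∑ k : Fin N,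
        ‖(divB (torusT P i) (fun κ z => unitsField (toUField U₀) ⟨z, κ⟩) (fun κ z => Rm ⟨z, κ⟩) x) j k‖ ^ 2
      ≤ N * (2 * P.d * ∑ μ : Fin P.d, (‖Rm ⟨x.unshift μ, μ⟩‖ ^ 2 + ‖Rm ⟨x, μ⟩‖ ^ 2)) := by
    intro x
    refine (sum_norm_sq_le_mul_opNorm_sq _).trans (mul_le_mul_of_nonneg_left ?_ hN)
    have h0 : 0 ≤ ‖divB (torusT P i) (fun κ z => unitsField (toUField U₀) ⟨z, κ⟩) (fun κ z => Rm ⟨z, κ⟩) x‖ := norm_nonneg _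
    have h1 := pow_le_pow_left₀ h0 (norm_divB_le_sum U₀ Rm x) 2
    refine h1.trans ?_
    -- Cauchy–Schwarz: `(Σ_μ c_μ)² ≤ d·Σ_μ c_μ²`, then `(a+b)² ≤ 2(a²+b²)`
    have hcs : (∑ μ : Fin P.d, (‖Rm ⟨x.unshift μ, μ⟩‖ + ‖Rm ⟨x, μ⟩‖)) ^ 2
        ≤ (Finset.univ : Finset (Fin P.d)).card * ∑ μ : Fin P.d, (‖Rm ⟨x.unshift μ, μ⟩‖ + ‖Rm ⟨x, μ⟩‖) ^ 2 :=
      sq_sum_le_card_mul_sum_sq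
    have hcard : ((Finset.univ : Finset (Fin P.d)).card : ℝ) = P.d := by simp
    rw [hcard] at hcs
    refine hcs.trans ?_
    have hin : ∑ μ : Fin P.d, (‖Rm ⟨x.unshift μ, μ⟩‖ + ‖Rm ⟨x, μ⟩‖) ^ 2 ≤ 2 * ∑ μ : Fin P.d, (‖Rm ⟨x.unshift μ, μ⟩‖ ^ 2 + ‖Rm ⟨x, μ⟩‖ ^ 2) := by
      rw [Finset.mul_sum]
      refine Finset.sum_le_sum fun μ _ => ?_
      nlinarith [sq_nonneg (‖Rm ⟨x.unshift μ, μ⟩‖ - ‖Rm ⟨x, μ⟩‖)]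
    have hd0 : (0 : ℝ) ≤ P.d := Nat.cast_nonneg (α := ℝ) P.d
    nlinarith [mul_le_mul_of_nonneg_left hin hd0]
  refine (Finset.sum_le_sum fun x _ => hpt x).trans ?_
  rw [← Finset.mul_sum, ← Finset.mul_sum]
  -- re-index the shifted slot and count: `Σ_x Σ_μ (a² + b²) = 2·Σ_b ‖Rm b‖²`
  have hshift : ∀ (κ : Fin P.d) (f : Site P i → ℝ), ∑ x : Site P i, f (x.unshift κ) = ∑ x : Site P i, f x := fun κ f => by
    have h := Equiv.sum_comp (torusT P i κ).symm f
    simpa only [torusT_symm_apply] using h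
  have hb : ∑ b : PBond P i, ‖Rm b‖ ^ 2 = ∑ x : Site P i, ∑ μ : Fin P.d, ‖Rm ⟨x, μ⟩‖ ^ 2 := sum_pbond _
  have hcount : ∑ x : Site P i, ∑ μ : Fin P.d, (‖Rm ⟨x.unshift μ, μ⟩‖ ^ 2 + ‖Rm ⟨x, μ⟩‖ ^ 2) = 2 * ∑ b : PBond P i, ‖Rm b‖ ^ 2 := by
    rw [hb, Finset.sum_comm]
    simp only [Finset.sum_add_distrib]
    rw [show ∑ μ : Fin P.d, ∑ x : Site P i, ‖Rm ⟨x.unshift μ, μ⟩‖ ^ 2 = ∑ μ : Fin P.d, ∑ x : Site P i, ‖Rm ⟨x, μ⟩‖ ^ 2 from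
      Finset.sum_congr rfl fun μ _ => hshift μ (fun y => ‖Rm ⟨y, μ⟩‖ ^ 2)]
    rw [Finset.sum_comm]
    ring
  rw [hcount]
  nlinarith [Finset.sum_nonneg fun b (_ : b ∈ (Finset.univ : Finset (PBond P i))) => sq_nonneg ‖Rm b‖, hN,
    mul_nonneg hN (Nat.cast_nonneg P.d)]

variable (U : GaugeField P i (Matrix.specialUnitaryGroup (Fin N) ℂ)) (X : PBond P i → Matrix (Fin N) (Fin N) ℂ)

omit [NeZero N] in
/-- The divergence is additive in the bond field (a splitting `Z = Z₁ + Z₂`). [folklore] -/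
theorem divB_eq_add_of_split (Z Z₁ Z₂ : PBond P i → Matrix (Fin N) (Fin N) ℂ) (hZ : ∀ b, Z b = Z₁ b + Z₂ b) (x : Site P i) :
    divB (torusT P i) (fun κ z => unitsField (toUField U₀) ⟨z, κ⟩) (fun κ z => Z ⟨z, κ⟩) x
      = divB (torusT P i) (fun κ z => unitsField (toUField U₀) ⟨z, κ⟩) (fun κ z => Z₁ ⟨z, κ⟩) x
        + divB (torusT P i) (fun κ z => unitsField (toUField U₀) ⟨z, κ⟩) (fun κ z => Z₂ ⟨z, κ⟩) x := by
  rw [divB_torus_eq, divB_torus_eq, divB_torus_eq, ← Finset.sum_add_distrib]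
  refine Finset.sum_congr rfl fun μ _ => ?_
  rw [hZ, hZ]
  simp only [mul_add, add_mul]
  abel

/-- ★★ **DIV, SECOND-ORDER EXCHANGE**: `DIV_HS(pertVar U₀ U) ≤ 2·DIV_HS(iX) + 2·N·d·s²·Σ_b‖X b‖²` (background `U₀` on both sides; `‖X b‖ ≤ s`).
[cite: Balaban1985Variational, (15) p.280, (19)-(20) p.281] [cite: Balaban1985BackgroundPropagators, (3.8) p.392] -/
theorem divHS_pertVar_le (hX : ∀ b, (X b).IsHermitian)
    (hU : ∀ b, ((U b : Matrix.specialUnitaryGroup (Fin N) ℂ) : Matrix (Fin N) (Fin N) ℂ)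
      = exp (Complex.I • X b) * ((U₀ b : Matrix.specialUnitaryGroup (Fin N) ℂ) : Matrix (Fin N) (Fin N) ℂ))
    {s : ℝ} (hs : ∀ b, ‖X b‖ ≤ s) :
    ∑ x : Site P i, ∑ j : Fin N, ∑ k : Fin N,
        ‖(divB (torusT P i) (fun κ z => unitsField (toUField U₀) ⟨z, κ⟩) (fun κ z => pertVar U₀ U ⟨z, κ⟩) x) j k‖ ^ 2
      ≤ 2 * ∑ x : Site P i, ∑ j : Fin N, ∑ k : Fin N,
          ‖(divB (torusT P i) (fun κ z => unitsField (toUField U₀) ⟨z, κ⟩) (fun κ z => Complex.I • X ⟨z, κ⟩) x) j k‖ ^ 2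
        + 2 * N * P.d * s ^ 2 * ∑ b : PBond P i, ‖X b‖ ^ 2 := by
  have hpt : ∀ x : Site P i, ∑ j : Fin N, ∑ k : Fin N,
        ‖(divB (torusT P i) (fun κ z => unitsField (toUField U₀) ⟨z, κ⟩) (fun κ z => pertVar U₀ U ⟨z, κ⟩) x) j k‖ ^ 2
      ≤ 2 * ∑ j : Fin N, ∑ k : Fin N,
          ‖(divB (torusT P i) (fun κ z => unitsField (toUField U₀) ⟨z, κ⟩) (fun κ z => Complex.I • X ⟨z, κ⟩) x) j k‖ ^ 2
        + 2 * ∑ j : Fin N, ∑ k : Fin N,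
          ‖(divB (torusT P i) (fun κ z => unitsField (toUField U₀) ⟨z, κ⟩) (fun κ z => pertVar U₀ U ⟨z, κ⟩ - Complex.I • X ⟨z, κ⟩) x) j k‖ ^ 2 := by
    intro x
    rw [divB_eq_add_of_split U₀ (pertVar U₀ U) (fun b => Complex.I • X b) (fun b => pertVar U₀ U b - Complex.I • X b) (fun b => by abel) x,
      Finset.mul_sum, Finset.mul_sum, ← Finset.sum_add_distrib]
    refine Finset.sum_le_sum fun j _ => ?_
    rw [Finset.mul_sum, Finset.mul_sum, ← Finset.sum_add_distrib]
    refine Finset.sum_le_sum fun k _ => ?_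
    rw [Matrix.add_apply]
    exact normSq_add_le _ _
  refine (Finset.sum_le_sum fun x _ => hpt x).trans ?_
  rw [Finset.sum_add_distrib, ← Finset.mul_sum, ← Finset.mul_sum]
  have hrem := divHS_le_bondMass U₀ (fun b => pertVar U₀ U b - Complex.I • X b)
  beta_reduce at hrem
  have hmass : ∑ b : PBond P i, ‖pertVar U₀ U b - Complex.I • X b‖ ^ 2 ≤ s ^ 2 / 4 * ∑ b : PBond P i, ‖X b‖ ^ 2 := by
    rw [Finset.mul_sum]
    exact Finset.sum_le_sum fun b _ => normSq_pertVar_sub_lin_le U₀ U X hX hU hs b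
  have hN : (0 : ℝ) ≤ 4 * N * P.d := by positivity
  nlinarith [mul_le_mul_of_nonneg_left hmass hN, hrem]

end Div

end Summit.QuantumFields.YangMills.Theorems.Prop7PertVarCurrencyExchange

end
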